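import Mathlib
import HarnessLib
import Summits.NavierStokesRegularity.NavierStokesRegularity.Theorems.PoloidalWindowDoorLrcModEntireCurvedParallelWebs

/-!
# Route `PoloidalWindowDoor`, item `LrcModEntire` (stmt-NavierStokesRegularity-20428), cell (Q4-sonic, straight, μ < 0) `stub_Q4sonicLineNeg`, case II —
# BRICK B-TWPc, PART T3a: THE CURVED HUYGENS IDENTITY AND «HUYGENS ⇒ PARALLEL WEBS» ON A LOCAL BOX (open-set / product versions of the g16 region theorems)

Cell ns-regularity-ideate, stub-worker seat ns-poloidal-K2-p2 g18 under the LEAD of item 20428 (ns-poloidal-K2-p3 g17/g18);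
`--supports stmt-NavierStokesRegularity-20428 --as helper`.  Memo `Cruxes/LrcModEntire/TOWER-CLOSES-port2g9.md` §D2/§E (B-TWPc), LEAD 2026-08-29T23:13:57Z, and this
seat's design word 23:29Z («B-TWPc LOCAL in σ»): the Fermi-frame time-web function over the curved base web of case II exists only on a local box around each
base point (T2 `…FermiTimeWebFunction`, one analytic implicit function), so the two Fermi-frame theorems of this seat's g16 files, stated there on the full region
`ℝ × I`, are re-issued here on an OPEN SET / a PRODUCT BOX.  The proofs are those of `…CurvedWebHuygens.curved_huygens_identity` and
`…CurvedParallelWebs.webFun_eq_of_curved_huygens` line by line (differentiation of identities valid on an open set; Grönwall in `z` at fixed `s`; local constancy in `s`).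

* `fderiv_eq_zero_of_eqOn_open` — a function vanishing on an open set has vanishing derivative there;
* ★ `curved_huygens_identity_on` — the six web identities along `W(s,z) = Γ(s) + G(s,z)·JΓ′(s) + z·e₂` on an open set `O ⊆ ℝ²` ⇒
  `κ(z)·(1 − k(s)G)²·(∂_zG)² = (R″(z) − μ(z)κ(z))·((1 − k(s)G)² + (∂_sG)²)` on `O`;
* ★ `webFun_eq_of_curved_huygens_on` — on a box `(a,b) × (−δ₁,δ₁)`: the curved Huygens relation with `κ > 0`, the Fermi factor non-vanishing and the pin `G(s,0) = 0`
  force `G(s,z) = G(s′,z)` (PARALLEL WEBS on the box).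

Class-free.  WHAT THIS IS NOT: not a claim about Navier–Stokes regularity; calculus for the research residue `stub_Q4sonicLineNegIsolated`
(bears_on LADDER-NS N0 via item 20428; items 20428 / 19708 / 27893 OPEN).
-/

noncomputable section

set_option linter.dupNamespace false
set_option linter.style.longLine false

namespace Summit.NavierStokesRegularity.NavierStokesRegularity.Theorems.PoloidalWindowDoorLrcModEntireCurvedHuygensLocal

open Set Function Filter Topology
open scoped InnerProductSpace RealInnerProductSpace ContDiff
open Summit.NavierStokesRegularity.NavierStokesRegularity.Theorems.PoloidalWindowDoorLrcModEntireSheetFlattenTools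
open Summit.NavierStokesRegularity.NavierStokesRegularity.Theorems.PoloidalWindowDoorLrcModEntireParallelWebsIdentity
open Summit.NavierStokesRegularity.NavierStokesRegularity.Theorems.PoloidalWindowDoorLrcModEntireParallelWebs
open Summit.NavierStokesRegularity.NavierStokesRegularity.Theorems.PoloidalWindowDoorLrcModEntireRidgeGlobalBranchODE
open Summit.NavierStokesRegularity.NavierStokesRegularity.Theorems.PoloidalWindowDoorLrcModEntireRidgeGlobalBranchFrame
open Summit.NavierStokesRegularity.NavierStokesRegularity.Theorems.PoloidalWindowDoorLrcModEntirePlanarCurveRigidity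
open Summit.NavierStokesRegularity.NavierStokesRegularity.Theorems.PoloidalWindowDoorLrcModEntireCurvedWebHuygens
open Summit.NavierStokesRegularity.NavierStokesRegularity.Theorems.PoloidalWindowDoorLrcModEntireCurvedParallelWebs

/-- A function vanishing on an open set has vanishing derivative there. -/
theorem fderiv_eq_zero_of_eqOn_open {O : Set (ℝ × ℝ)} (hO : IsOpen O) {φ : ℝ × ℝ → ℝ} (hφ : ∀ p ∈ O, φ p = 0)
    {p : ℝ × ℝ} (hp : p ∈ O) (h : ℝ × ℝ) : fderiv ℝ φ p h = 0 := by
  have hev : φ =ᶠ[𝓝 p] fun _ => 0 := Filter.eventuallyEq_of_mem (hO.mem_nhds hp) fun q hq => hφ q hq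
  rw [hev.fderiv_eq]; simp

section huygens

variable {Γ : ℝ → EuclideanSpace ℝ (Fin 3)} {k : ℝ → ℝ}

/-- ★ **THE CURVED HUYGENS IDENTITY ON AN OPEN SET** (`…CurvedWebHuygens.curved_huygens_identity` with the region `ℝ × I` replaced by an open `O ⊆ ℝ²`). -/
theorem curved_huygens_identity_on {F : EuclideanSpace ℝ (Fin 3) → ℝ} (hF : ContDiff ℝ 3 F)
    {Γ : ℝ → EuclideanSpace ℝ (Fin 3)} (hΓ : ContDiff ℝ 2 Γ) (hpl : ∀ s, Γ s 2 = 0)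
    {k : ℝ → ℝ} (hk : ∀ s, deriv (deriv Γ) s = k s • rotJ (deriv Γ s))
    {O : Set (ℝ × ℝ)} (hO : IsOpen O) {G : ℝ × ℝ → ℝ} (hG : ∀ p ∈ O, DifferentiableAt ℝ G p)
    {R κ μ : ℝ → ℝ} (hR : ∀ p ∈ O, HasDerivAt (deriv R) (deriv (deriv R) p.2) p.2)
    (hR1 : ∀ p ∈ O, DifferentiableAt ℝ R p.2)
    (hν : ∀ p ∈ O, fderiv ℝ F (Γ p.1 + G p • rotJ (deriv Γ p.1) + p.2 • e2) (rotJ (deriv Γ p.1)) = 0)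
    (hT : ∀ p ∈ O, fderiv ℝ F (Γ p.1 + G p • rotJ (deriv Γ p.1) + p.2 • e2) (deriv Γ p.1) = 0)
    (hval : ∀ p ∈ O, F (Γ p.1 + G p • rotJ (deriv Γ p.1) + p.2 • e2) = R p.2)
    (hridge : ∀ p ∈ O,
      fderiv ℝ (fderiv ℝ F) (Γ p.1 + G p • rotJ (deriv Γ p.1) + p.2 • e2) (deriv Γ p.1) (deriv Γ p.1) +
        fderiv ℝ (fderiv ℝ F) (Γ p.1 + G p • rotJ (deriv Γ p.1) + p.2 • e2) (rotJ (deriv Γ p.1)) (rotJ (deriv Γ p.1)) = -κ p.2)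
    (hslice : ∀ p ∈ O,
      fderiv ℝ (fderiv ℝ F) (Γ p.1 + G p • rotJ (deriv Γ p.1) + p.2 • e2) e2 e2 =
        -μ p.2 * (fderiv ℝ (fderiv ℝ F) (Γ p.1 + G p • rotJ (deriv Γ p.1) + p.2 • e2) (deriv Γ p.1) (deriv Γ p.1) +
          fderiv ℝ (fderiv ℝ F) (Γ p.1 + G p • rotJ (deriv Γ p.1) + p.2 • e2) (rotJ (deriv Γ p.1)) (rotJ (deriv Γ p.1))))
    {p : ℝ × ℝ} (hp : p ∈ O) :
    κ p.2 * (1 - k p.1 * G p) ^ 2 * (fderiv ℝ G p (0, 1)) ^ 2 =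
      (deriv (deriv R) p.2 - μ p.2 * κ p.2) * ((1 - k p.1 * G p) ^ 2 + (fderiv ℝ G p (1, 0)) ^ 2) := by
  set W : ℝ × ℝ → EuclideanSpace ℝ (Fin 3) := fun q => Γ q.1 + G q • rotJ (deriv Γ q.1) + q.2 • e2 with hW
  set x := W p with hx
  set B := fderiv ℝ (fderiv ℝ F) x with hB
  set T := deriv Γ p.1 with hTdef
  set ν := rotJ (deriv Γ p.1) with hνdef
  set J := 1 - k p.1 * G p with hJ
  have hF1 : Differentiable ℝ F := hF.differentiable (by norm_num)
  have hF2 : ContDiff ℝ 2 F := hF.of_le (by norm_num)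
  have hDF : ∀ y, DifferentiableAt ℝ (fderiv ℝ F) y := fun y =>
    ((hF.fderiv_right (m := 2) (by norm_num)).differentiable (by norm_num)) y
  have hsymm : ∀ a c : EuclideanSpace ℝ (Fin 3), B a c = B c a := fun a c =>
    (hF2.contDiffAt.isSymmSndFDerivAt (by simp)) a c
  have hGp := hG p hp
  have hTd : HasDerivAt (deriv Γ) (k p.1 • rotJ (deriv Γ p.1)) p.1 := by
    have h := (hasDerivAt_of_contDiff_two hΓ p.1).2; rwa [hk p.1] at h
  have hNd : HasDerivAt (fun t => rotJ (deriv Γ t)) (-(k p.1) • deriv Γ p.1) p.1 := hasDerivAt_normal hΓ hpl hk p.1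
  have hT0 : fderiv ℝ F (Γ p.1 + G p • rotJ (deriv Γ p.1) + p.2 • e2) (deriv Γ p.1) = 0 := hT p hp
  have hν0 : fderiv ℝ F (Γ p.1 + G p • rotJ (deriv Γ p.1) + p.2 • e2) (rotJ (deriv Γ p.1)) = 0 := hν p hp
  have I1s : J * B T ν + fderiv ℝ G p (1, 0) * B ν ν = 0 := by
    have h := fderiv_eq_zero_of_eqOn_open hO hν hp (1, 0)
    rw [fderiv_moving_deriv hΓ hpl hk hGp hF2 hNd] at h
    simp only [map_add, map_smul, _root_.add_apply, _root_.smul_apply, smul_eq_mul] at h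
    simp only [hB, hJ, hTdef, hνdef, hx, hW]
    linear_combination h + k p.1 * hT0
  have I1z : fderiv ℝ G p (0, 1) * B ν ν + B e2 ν = 0 := by
    have h := fderiv_eq_zero_of_eqOn_open hO hν hp (0, 1)
    rw [fderiv_moving_deriv hΓ hpl hk hGp hF2 hNd] at h
    simp only [map_add, map_smul, _root_.add_apply, _root_.smul_apply, smul_eq_mul] at h
    simp only [hB, hνdef, hx, hW]
    linear_combination h
  have I2s : J * B T T + fderiv ℝ G p (1, 0) * B ν T = 0 := by
    have h := fderiv_eq_zero_of_eqOn_open hO hT hp (1, 0)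
    rw [fderiv_moving_deriv hΓ hpl hk hGp hF2 hTd] at h
    simp only [map_add, map_smul, _root_.add_apply, _root_.smul_apply, smul_eq_mul] at h
    simp only [hB, hJ, hTdef, hνdef, hx, hW]
    linear_combination h - k p.1 * hν0
  -- (I3) `F(W) = R(z)` differentiated in `z`: `∂_{e₂}F(W) = R′(z)` on the region, then once more
  have I3a : ∀ q ∈ O, fderiv ℝ F (W q) e2 = deriv R q.2 := by
    intro q hq
    have hGq := hG q hq
    have hd : fderiv ℝ (fun q' => F (W q')) q (0, 1) = fderiv ℝ (fun q' : ℝ × ℝ => R q'.2) q (0, 1) := by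
      have hev : (fun q' => F (W q')) =ᶠ[𝓝 q] fun q' : ℝ × ℝ => R q'.2 :=
        Filter.eventuallyEq_of_mem (hO.mem_nhds hq) fun q' hq' => hval q' hq'
      rw [hev.fderiv_eq]
    rw [hW, fderiv_comp_curvedWeb hΓ hpl hk hGq (hF1 _) (0, 1)] at hd
    have hRd : fderiv ℝ (fun q' : ℝ × ℝ => R q'.2) q (0, 1) = deriv R q.2 := by
      have hc : HasFDerivAt (fun q' : ℝ × ℝ => R q'.2)
          ((fderiv ℝ R q.2).comp (ContinuousLinearMap.snd ℝ ℝ ℝ)) q :=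
        HasFDerivAt.comp q (hR1 q hq).hasFDerivAt hasFDerivAt_snd
      rw [hc.fderiv]
      simp
    rw [hRd] at hd
    have hlin : fderiv ℝ F (W q) ((((0 : ℝ), (1 : ℝ)).1 * (1 - k q.1 * G q)) • deriv Γ q.1 + fderiv ℝ G q (0, 1) • rotJ (deriv Γ q.1) +
        ((0 : ℝ), (1 : ℝ)).2 • e2) = fderiv ℝ G q (0, 1) * fderiv ℝ F (W q) (rotJ (deriv Γ q.1)) + fderiv ℝ F (W q) e2 := by
      simp [map_add, map_smul, smul_eq_mul]
    rw [hlin, hν q hq, mul_zero, zero_add] at hd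
    exact hd
  have I3 : fderiv ℝ G p (0, 1) * B e2 ν + B e2 e2 = deriv (deriv R) p.2 := by
    have hφ : ∀ q ∈ O, (fun q => fderiv ℝ F (W q) e2 - deriv R q.2) q = 0 := fun q hq => by
      simp [I3a q hq]
    have h := fderiv_eq_zero_of_eqOn_open hO hφ hp (0, 1)
    have hd1 : DifferentiableAt ℝ (fun q => fderiv ℝ F (W q) e2) p :=
      ((hDF _).clm_apply (differentiableAt_const e2)).comp p (differentiableAt_curvedWeb hΓ hpl hk hGp)
    have hd2 : DifferentiableAt ℝ (fun q : ℝ × ℝ => deriv R q.2) p := (hR p hp).differentiableAt.comp p differentiableAt_snd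
    rw [fderiv_fun_sub hd1 hd2] at h
    have hRd : fderiv ℝ (fun q : ℝ × ℝ => deriv R q.2) p (0, 1) = deriv (deriv R) p.2 := by
      have hc : HasFDerivAt (fun q' : ℝ × ℝ => deriv R q'.2)
          ((ContinuousLinearMap.smulRight (1 : ℝ →L[ℝ] ℝ) (deriv (deriv R) p.2)).comp (ContinuousLinearMap.snd ℝ ℝ ℝ)) p :=
        (hR p hp).hasFDerivAt.comp p hasFDerivAt_snd
      rw [hc.fderiv]
      simp
    have hce2 : fderiv ℝ (fun q => fderiv ℝ F (W q) e2) p (0, 1) = fderiv ℝ G p (0, 1) * B ν e2 + B e2 e2 := by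
      have h0 := fderiv_moving_deriv hΓ hpl hk hGp hF2 (V := fun _ => e2) (V' := 0) (hasDerivAt_const p.1 e2) (0, 1)
      rw [hW, h0]
      simp only [map_add, map_smul, map_zero, _root_.add_apply, _root_.smul_apply, smul_eq_mul, mul_zero, add_zero,
        zero_mul, zero_smul, zero_add, one_smul]
      simp only [hB, hνdef, hx, hW]
    rw [_root_.sub_apply, hce2, hRd, hsymm ν e2] at h
    linarith
  have hr := hridge p hp
  have hsl := hslice p hp
  exact curved_huygens_algebra (b := B ν ν) (Btn := B T ν) (Bzn := B e2 ν) (Btt := B T T) (Bzz := B e2 e2)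
    (Gs := fderiv ℝ G p (1, 0)) (Gz := fderiv ℝ G p (0, 1)) (J := J) (κ := κ p.2) (μ := μ p.2) (R2 := deriv (deriv R) p.2)
    I1s (by linear_combination I1z) (by rw [hsymm ν T] at I2s; exact I2s) hr I3 hsl


end huygens

/-- ★ **CURVED HUYGENS ⇒ PARALLEL WEBS ON A BOX** (`…CurvedParallelWebs.webFun_eq_of_curved_huygens` with the region `ℝ × (−δ₁,δ₁)` replaced by the box
`(a,b) × (−δ₁,δ₁)` and the pin `G(s,0) = 0` for `s ∈ (a,b)`): `G(s,z) = G(s′,z)` on the box. -/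
theorem webFun_eq_of_curved_huygens_on {G : ℝ × ℝ → ℝ} {a b δ₁ : ℝ} (hδ₁ : 0 < δ₁)
    (hG : ContDiffOn ℝ 2 G (Ioo a b ×ˢ Ioo (-δ₁) δ₁))
    {κ c k : ℝ → ℝ} (hκ : ∀ z ∈ Ioo (-δ₁) δ₁, 0 < κ z)
    (hκd : ∀ z ∈ Ioo (-δ₁) δ₁, DifferentiableAt ℝ κ z) (hcd : ∀ z ∈ Ioo (-δ₁) δ₁, DifferentiableAt ℝ c z)
    (hk : Differentiable ℝ k)
    (hJ : ∀ p ∈ Ioo a b ×ˢ Ioo (-δ₁) δ₁, 1 - k p.1 * G p ≠ 0)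
    (hrel : ∀ p ∈ Ioo a b ×ˢ Ioo (-δ₁) δ₁,
      κ p.2 * (1 - k p.1 * G p) ^ 2 * (fderiv ℝ G p (0, 1)) ^ 2 = c p.2 * ((1 - k p.1 * G p) ^ 2 + (fderiv ℝ G p (1, 0)) ^ 2))
    (h0 : ∀ s ∈ Ioo a b, G (s, 0) = 0) :
    ∀ s ∈ Ioo a b, ∀ s' ∈ Ioo a b, ∀ z ∈ Ioo (-δ₁) δ₁, G (s, z) = G (s', z) := by
  set I := Ioo (-δ₁) δ₁ with hI
  set S := Ioo a b with hS
  have hIo : IsOpen I := isOpen_Ioo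
  have hSo : IsOpen S := isOpen_Ioo
  have hRo : IsOpen (S ×ˢ I) := hSo.prod hIo
  have h0I : (0 : ℝ) ∈ I := ⟨by linarith, hδ₁⟩
  have hGat : ∀ p ∈ S ×ˢ I, ContDiffAt ℝ 2 G p := fun p hp => hG.contDiffAt (hRo.mem_nhds hp)
  have hGd : ∀ p ∈ S ×ˢ I, DifferentiableAt ℝ G p := fun p hp => (hGat p hp).differentiableAt (by norm_num)
  have hDG : ∀ p ∈ S ×ˢ I, DifferentiableAt ℝ (fderiv ℝ G) p := fun p hp =>
    ((hGat p hp).fderiv_right (m := 1) (by norm_num)).differentiableAt (by norm_num)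
  set H : ℝ × ℝ → ℝ := fun p => fderiv ℝ G p (1, 0) with hH
  set Z : ℝ × ℝ → ℝ := fun p => fderiv ℝ G p (0, 1) with hZ
  set Jf : ℝ × ℝ → ℝ := fun p => 1 - k p.1 * G p with hJf
  have hHd : ∀ p ∈ S ×ˢ I, DifferentiableAt ℝ H p := fun p hp => (hDG p hp).clm_apply (differentiableAt_const _)
  have hZd : ∀ p ∈ S ×ˢ I, DifferentiableAt ℝ Z p := fun p hp => (hDG p hp).clm_apply (differentiableAt_const _)
  have hHfd : ∀ p ∈ S ×ˢ I, ∀ w, fderiv ℝ H p w = fderiv ℝ (fderiv ℝ G) p w (1, 0) := fun p hp w => by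
    rw [hH, fderiv_clm_apply (hDG p hp) (differentiableAt_const _)]; simp
  have hZfd : ∀ p ∈ S ×ˢ I, ∀ w, fderiv ℝ Z p w = fderiv ℝ (fderiv ℝ G) p w (0, 1) := fun p hp w => by
    rw [hZ, fderiv_clm_apply (hDG p hp) (differentiableAt_const _)]; simp
  -- symmetry of the mixed partials: `∂_s Z = ∂_z H`
  have hmix : ∀ p ∈ S ×ˢ I, fderiv ℝ Z p (1, 0) = fderiv ℝ H p (0, 1) := fun p hp => by
    rw [hHfd p hp, hZfd p hp]
    exact (hGat p hp).isSymmSndFDerivAt (by simp) (1, 0) (0, 1)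
  -- `H` is `C¹` on the box (for the continuity of `∂_sH`)
  have hH1 : ContDiffOn ℝ 1 H (S ×ˢ I) := by
    have h := (hG.fderiv_of_isOpen hRo (m := 1) (by norm_num)).clm_apply contDiffOn_const (g := fun _ => ((1 : ℝ), (0 : ℝ)))
    exact h
  have hHcont : ContinuousOn (fun p => fderiv ℝ H p (1, 0)) (S ×ˢ I) :=
    ((hH1.fderiv_of_isOpen hRo (m := 0) (by norm_num)).continuousOn).clm_apply continuousOn_const
  have hGcont : ContinuousOn G (S ×ˢ I) := hG.continuousOn
  have hHc : ContinuousOn H (S ×ˢ I) := hH1.continuousOn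
  -- the Fermi factor and its `s`-derivative `J_s = −(k′ G + k H)`
  have hkf : ∀ p : ℝ × ℝ, HasFDerivAt (fun q : ℝ × ℝ => k q.1) ((fderiv ℝ k p.1).comp (ContinuousLinearMap.fst ℝ ℝ ℝ)) p := fun p =>
    (hk p.1).hasFDerivAt.comp p hasFDerivAt_fst
  have hJf' : ∀ p ∈ S ×ˢ I, HasFDerivAt Jf
      (0 - (k p.1 • fderiv ℝ G p + G p • (fderiv ℝ k p.1).comp (ContinuousLinearMap.fst ℝ ℝ ℝ))) p := fun p hp =>
    (hasFDerivAt_const (1 : ℝ) p).sub ((hkf p).mul (hGd p hp).hasFDerivAt)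
  -- (T): `κ J³ Z ∂_zH = c H (J ∂_sH + (k′G + kH) H)`
  have hT : ∀ p ∈ S ×ˢ I, κ p.2 * Jf p ^ 3 * Z p * fderiv ℝ H p (0, 1) =
      c p.2 * H p * (Jf p * fderiv ℝ H p (1, 0) + (fderiv ℝ k p.1 1 * G p + k p.1 * H p) * H p) := by
    intro p hp
    have hΦ : ∀ q ∈ S ×ˢ I, (fun q : ℝ × ℝ => κ q.2 * (Jf q * Jf q * (Z q * Z q)) - c q.2 * (Jf q * Jf q + H q * H q)) q = 0 :=
      fun q hq => by
        have := hrel q hq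
        simp only [hH, hZ, hJf]
        nlinarith [this]
    have h := fderiv_eq_zero_of_eqOn_open hRo hΦ hp (1, 0)
    have hκ' : HasFDerivAt (fun q : ℝ × ℝ => κ q.2) ((fderiv ℝ κ p.2).comp (ContinuousLinearMap.snd ℝ ℝ ℝ)) p :=
      (hκd p.2 hp.2).hasFDerivAt.comp p hasFDerivAt_snd
    have hc' : HasFDerivAt (fun q : ℝ × ℝ => c q.2) ((fderiv ℝ c p.2).comp (ContinuousLinearMap.snd ℝ ℝ ℝ)) p :=
      (hcd p.2 hp.2).hasFDerivAt.comp p hasFDerivAt_snd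
    have hZ' : HasFDerivAt Z (fderiv ℝ Z p) p := (hZd p hp).hasFDerivAt
    have hH' : HasFDerivAt H (fderiv ℝ H p) p := (hHd p hp).hasFDerivAt
    have hJ' := hJf' p hp
    have hΦ' := (hκ'.mul ((hJ'.mul hJ').mul (hZ'.mul hZ'))).sub (hc'.mul ((hJ'.mul hJ').add (hH'.mul hH')))
    have hΦ'' : HasFDerivAt (fun q : ℝ × ℝ => κ q.2 * (Jf q * Jf q * (Z q * Z q)) - c q.2 * (Jf q * Jf q + H q * H q)) _ p := hΦ'
    rw [hΦ''.fderiv] at h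
    simp only [_root_.sub_apply, _root_.add_apply, _root_.neg_apply, _root_.smul_apply, smul_eq_mul, ContinuousLinearMap.coe_comp,
      Function.comp_apply, ContinuousLinearMap.coe_snd', ContinuousLinearMap.coe_fst', Pi.mul_apply, Pi.add_apply,
      map_zero, mul_zero, add_zero, zero_sub] at h
    rw [hmix p hp] at h
    have hr := hrel p hp
    have hHp : fderiv ℝ G p (1, 0) = H p := rfl
    have hZp : fderiv ℝ G p (0, 1) = Z p := rfl
    rw [hHp, hZp] at hr
    rw [hHp] at h
    change κ p.2 * Jf p ^ 2 * Z p ^ 2 = c p.2 * (Jf p ^ 2 + H p ^ 2) at hr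
    linear_combination (Jf p / 2) * h + (fderiv ℝ k p.1 1 * G p + k p.1 * H p) * hr
  -- where `G_z = 0` the height is a zero of `c` and `∂_zH = 0`
  have hdeg : ∀ p ∈ S ×ˢ I, Z p = 0 → fderiv ℝ H p (0, 1) = 0 := by
    intro p hp hZ0
    have hc0 : c p.2 = 0 := by
      have h := hrel p hp
      rw [show fderiv ℝ G p (0, 1) = Z p from rfl, hZ0] at h
      have h1 : c p.2 * ((1 - k p.1 * G p) ^ 2 + H p ^ 2) = 0 := by
        rw [show fderiv ℝ G p (1, 0) = H p from rfl] at h; linear_combination -h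
      rcases mul_eq_zero.1 h1 with h2 | h2
      · exact h2
      · exfalso
        have hJp := hJ p hp
        have : 0 < (1 - k p.1 * G p) ^ 2 := by positivity
        nlinarith [sq_nonneg (H p)]
    -- `Z` vanishes on the horizontal segment `S × {p.2}`
    have hZline : ∀ s ∈ S, Z (s, p.2) = 0 := by
      intro s hs
      have hq : ((s, p.2) : ℝ × ℝ) ∈ S ×ˢ I := ⟨hs, hp.2⟩
      have h := hrel (s, p.2) hq
      rw [hc0, zero_mul] at h
      have hJq := hJ (s, p.2) hq
      have := mul_eq_zero.1 h
      rcases this with h1 | h1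
      · rcases mul_eq_zero.1 h1 with h2 | h2
        · exact absurd h2 (hκ p.2 hp.2).ne'
        · exact absurd (pow_eq_zero_iff (n := 2) (by norm_num) |>.1 h2) hJq
      · exact pow_eq_zero_iff (n := 2) (by norm_num) |>.1 h1
    rw [← hmix p hp, fderiv_apply_one_zero_eq_deriv (hZd p hp)]
    have hev : (fun s : ℝ => Z (s, p.2)) =ᶠ[𝓝 p.1] fun _ => 0 :=
      Filter.eventuallyEq_of_mem (hSo.mem_nhds hp.1) fun s hs => hZline s hs
    rw [hev.deriv_eq, deriv_const]
  -- the Grönwall bound along a vertical segment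
  have hmain : ∀ s ∈ S, ∀ (b' : ℝ), 0 ≤ b' → b' < δ₁ → ∀ z ∈ Icc (-b') b', H (s, z) = 0 := by
    intro s hs b' hb hbδ
    have hKI : ∀ z ∈ Icc (-b') b', z ∈ I := fun z hz => ⟨by linarith [hz.1], by linarith [hz.2]⟩
    obtain ⟨A, hA⟩ : ∃ A, ∀ z ∈ Icc (-b') b',
        Real.sqrt (c z / κ z) * |Jf (s, z) * fderiv ℝ H (s, z) (1, 0) + (fderiv ℝ k s 1 * G (s, z) + k s * H (s, z)) * H (s, z)| /
          |Jf (s, z)| ^ 3 ≤ A := by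
      have hline : ContinuousOn (fun z : ℝ => ((s, z) : ℝ × ℝ)) (Icc (-b') b') := (continuous_const.prodMk continuous_id).continuousOn
      have hmaps : MapsTo (fun z : ℝ => ((s, z) : ℝ × ℝ)) (Icc (-b') b') (S ×ˢ I) := fun z hz => ⟨hs, hKI z hz⟩
      have hGl : ContinuousOn (fun z => G (s, z)) (Icc (-b') b') := hGcont.comp hline hmaps
      have hHl : ContinuousOn (fun z => H (s, z)) (Icc (-b') b') := hHc.comp hline hmaps
      have hHsl : ContinuousOn (fun z => fderiv ℝ H (s, z) (1, 0)) (Icc (-b') b') := hHcont.comp hline hmaps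
      have hJl : ContinuousOn (fun z => Jf (s, z)) (Icc (-b') b') := by
        simp only [hJf]; exact continuousOn_const.sub (continuousOn_const.mul hGl)
      have hcont : ContinuousOn (fun z => Real.sqrt (c z / κ z) *
          |Jf (s, z) * fderiv ℝ H (s, z) (1, 0) + (fderiv ℝ k s 1 * G (s, z) + k s * H (s, z)) * H (s, z)| / |Jf (s, z)| ^ 3)
          (Icc (-b') b') := by
        have hcκ : ContinuousOn (fun z => c z / κ z) (Icc (-b') b') := by
          refine ContinuousOn.div ?_ ?_ fun z hz => (hκ z (hKI z hz)).ne'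
          · exact fun z hz => (hcd z (hKI z hz)).continuousAt.continuousWithinAt
          · exact fun z hz => (hκd z (hKI z hz)).continuousAt.continuousWithinAt
        refine ContinuousOn.div ((hcκ.sqrt).mul (continuous_abs.comp_continuousOn ?_)) ((continuous_abs.comp_continuousOn hJl).pow 3)
          fun z hz => ?_
        · exact (hJl.mul hHsl).add (((continuousOn_const.mul hGl).add (continuousOn_const.mul hHl)).mul hHl)
        · exact pow_ne_zero 3 (abs_ne_zero.2 (hJ (s, z) ⟨hs, hKI z hz⟩))
      obtain ⟨A, hA⟩ := (isCompact_Icc : IsCompact (Icc (-b') b')).exists_bound_of_continuousOn hcont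
      exact ⟨A, fun z hz => (le_abs_self _).trans (by have h := hA z hz; rwa [Real.norm_eq_abs] at h)⟩
    -- the differential inequality
    set h : ℝ → ℝ := fun z => H (s, z) with hh
    have hhd : ∀ z ∈ Icc (-b') b', HasDerivAt h (fderiv ℝ H (s, z) (0, 1)) z := by
      intro z hz
      have hp : ((s, z) : ℝ × ℝ) ∈ S ×ˢ I := ⟨hs, hKI z hz⟩
      have h1 : HasFDerivAt H (fderiv ℝ H (s, z)) ((fun z : ℝ => ((s, z) : ℝ × ℝ)) z) := (hHd _ hp).hasFDerivAt
      exact h1.comp_hasDerivAt z (hasDerivAt_vertical_line s z)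
    have hderiv : ∀ z ∈ Icc (-b') b', deriv h z = fderiv ℝ H (s, z) (0, 1) := fun z hz => (hhd z hz).deriv
    have hineq : ∀ z ∈ Icc (-b') b', |deriv h z| ≤ A * |h z| := by
      intro z hz
      have hzI : z ∈ I := hKI z hz
      have hp : ((s, z) : ℝ × ℝ) ∈ S ×ˢ I := ⟨hs, hzI⟩
      have hJp : Jf (s, z) ≠ 0 := hJ (s, z) hp
      have hJ3 : 0 < |Jf (s, z)| ^ 3 := pow_pos (abs_pos.2 hJp) 3
      have hA0 : 0 ≤ A := le_trans (div_nonneg (mul_nonneg (Real.sqrt_nonneg _) (abs_nonneg _)) hJ3.le) (hA z hz)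
      rw [hderiv z hz]
      by_cases hZ0 : Z (s, z) = 0
      · rw [hdeg _ hp hZ0, abs_zero]
        exact mul_nonneg hA0 (abs_nonneg _)
      · have hκz : 0 < κ z := hκ z hzI
        have hr := hrel (s, z) hp
        change κ z * Jf (s, z) ^ 2 * Z (s, z) ^ 2 = c z * (Jf (s, z) ^ 2 + H (s, z) ^ 2) at hr
        have hJ2 : 0 < Jf (s, z) ^ 2 := by positivity
        have hc0 : 0 ≤ c z := by
          have h1 : 0 ≤ c z * (Jf (s, z) ^ 2 + H (s, z) ^ 2) := by rw [← hr]; positivity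
          have h2 : 0 < Jf (s, z) ^ 2 + H (s, z) ^ 2 := by nlinarith [sq_nonneg (H (s, z))]
          exact nonneg_of_mul_nonneg_left h1 h2 |> fun h => by nlinarith [h1, h2, mul_nonneg_iff.1 h1]
        set q : ℝ := Real.sqrt (c z / κ z) with hq
        have hq0 : 0 ≤ q := Real.sqrt_nonneg _
        have hq2 : q ^ 2 = c z / κ z := Real.sq_sqrt (div_nonneg hc0 hκz.le)
        have hqZ : q ≤ |Z (s, z)| := by
          have h1 : q ^ 2 ≤ |Z (s, z)| ^ 2 := by
            rw [hq2, sq_abs, div_le_iff₀ hκz]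
            nlinarith [sq_nonneg (H (s, z)), sq_nonneg (Z (s, z)), mul_nonneg hc0 (sq_nonneg (H (s, z)))]
          exact (pow_le_pow_iff_left₀ hq0 (abs_nonneg _) two_ne_zero).1 h1
        have hTz := hT (s, z) hp
        set M : ℝ := Jf (s, z) * fderiv ℝ H (s, z) (1, 0) + (fderiv ℝ k s 1 * G (s, z) + k s * H (s, z)) * H (s, z) with hM
        change κ z * Jf (s, z) ^ 3 * Z (s, z) * fderiv ℝ H (s, z) (0, 1) = c z * H (s, z) * M at hTz
        have hcle : c z ≤ κ z * q * |Z (s, z)| := by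
          have : c z = κ z * q ^ 2 := by rw [hq2]; field_simp
          rw [this]
          have := mul_le_mul_of_nonneg_left hqZ (mul_nonneg hκz.le hq0)
          nlinarith [this]
        have habs : κ z * |Jf (s, z)| ^ 3 * |Z (s, z)| * |fderiv ℝ H (s, z) (0, 1)| = c z * |H (s, z)| * |M| := by
          have := congrArg abs hTz
          simpa [abs_mul, abs_pow, abs_of_pos hκz, abs_of_nonneg hc0, mul_assoc] using this
        have hZpos : 0 < |Z (s, z)| := abs_pos.2 hZ0
        have hprod : 0 < κ z * |Jf (s, z)| ^ 3 * |Z (s, z)| := mul_pos (mul_pos hκz hJ3) hZpos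
        have hgoal : |fderiv ℝ H (s, z) (0, 1)| ≤ q * |M| / |Jf (s, z)| ^ 3 * |H (s, z)| := by
          refine le_of_mul_le_mul_left ?_ hprod
          calc κ z * |Jf (s, z)| ^ 3 * |Z (s, z)| * |fderiv ℝ H (s, z) (0, 1)|
              = c z * |H (s, z)| * |M| := habs
            _ ≤ (κ z * q * |Z (s, z)|) * |H (s, z)| * |M| := by gcongr
            _ = κ z * |Jf (s, z)| ^ 3 * |Z (s, z)| * (q * |M| / |Jf (s, z)| ^ 3 * |H (s, z)|) := by
                field_simp
        calc |fderiv ℝ H (s, z) (0, 1)| ≤ q * |M| / |Jf (s, z)| ^ 3 * |H (s, z)| := hgoal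
          _ ≤ A * |H (s, z)| := by
              have := hA z hz
              exact mul_le_mul_of_nonneg_right this (abs_nonneg _)
    have hh0 : h 0 = 0 := by
      change H (s, 0) = 0
      have hp0 : ((s, (0 : ℝ)) : ℝ × ℝ) ∈ S ×ˢ I := ⟨hs, h0I⟩
      change fderiv ℝ G (s, 0) (1, 0) = 0
      rw [fderiv_apply_one_zero_eq_deriv (hGd _ hp0)]
      have hev : (fun s' : ℝ => G (s', ((s, (0 : ℝ)) : ℝ × ℝ).2)) =ᶠ[𝓝 s] fun _ => 0 :=
        Filter.eventuallyEq_of_mem (hSo.mem_nhds hs) fun s' hs' => h0 s' hs'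
      rw [show ((s, (0 : ℝ)) : ℝ × ℝ).1 = s from rfl, hev.deriv_eq, deriv_const]
    have hhd' : ∀ z ∈ Icc (-b') b', HasDerivAt h (deriv h z) z := fun z hz => by rw [hderiv z hz]; exact hhd z hz
    exact eq_zero_of_abs_deriv_le hb hhd' hineq hh0
  -- conclusion: `s ↦ G(s,z)` has zero derivative on the interval `S`
  intro s hs s' hs' z hz
  set b' : ℝ := (|z| + δ₁) / 2 with hb'
  have hzabs : |z| < δ₁ := abs_lt.2 ⟨by linarith [hz.1], hz.2⟩
  have hb0 : 0 ≤ b' := by rw [hb']; positivity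
  have hbδ : b' < δ₁ := by rw [hb']; linarith
  have hzb : z ∈ Icc (-b') b' := by
    constructor <;> [have := neg_abs_le z; have := le_abs_self z] <;> rw [hb'] <;> linarith
  have hline : ∀ u ∈ S, HasDerivAt (fun s'' : ℝ => G (s'', z)) 0 u := by
    intro u hu
    have hp : ((u, z) : ℝ × ℝ) ∈ S ×ˢ I := ⟨hu, hz⟩
    have h1 : HasFDerivAt G (fderiv ℝ G (u, z)) ((fun s'' : ℝ => ((s'', z) : ℝ × ℝ)) u) := (hGd _ hp).hasFDerivAt
    have h2 : HasDerivAt (fun s'' : ℝ => ((s'', z) : ℝ × ℝ)) ((1 : ℝ), (0 : ℝ)) u :=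
      (hasDerivAt_id u).prodMk (hasDerivAt_const u z)
    have h3 : HasDerivAt (fun s'' : ℝ => G (s'', z)) (fderiv ℝ G (u, z) ((1 : ℝ), (0 : ℝ))) u := h1.comp_hasDerivAt u h2
    have hH0 : fderiv ℝ G (u, z) (1, 0) = 0 := hmain u hu b' hb0 hbδ z hzb
    rw [hH0] at h3
    exact h3
  have hdiff : DifferentiableOn ℝ (fun s'' : ℝ => G (s'', z)) S := fun u hu => (hline u hu).differentiableAt.differentiableWithinAt
  have hzero : ∀ u ∈ S, fderivWithin ℝ (fun s'' : ℝ => G (s'', z)) S u = 0 := by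
    intro u hu
    rw [fderivWithin_of_isOpen hSo hu, (hline u hu).hasFDerivAt.fderiv]
    ext; simp
  exact (convex_Ioo a b).is_const_of_fderivWithin_eq_zero hdiff hzero hs hs'

end Summit.NavierStokesRegularity.NavierStokesRegularity.Theorems.PoloidalWindowDoorLrcModEntireCurvedHuygensLocal

end
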